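import Mathlib
import Summits.Ventures.PercRepro2.Defs
import Summits.Ventures.PercRepro2.Graph
import Summits.Ventures.PercRepro2.HubModel
import Summits.Ventures.PercRepro2.HubModel3
import Summits.Ventures.PercRepro2.HubLaw3

/-!
# The inner pattern of the a₃-hub is a set partition: only the 15 consistent patterns carry mass
(blind cell PercRepro2, mine-2 g15; MINE2-A3FIRST.md §3)

The inner pattern `innerPat3 ends μ ω : Fin 6 → Bool` records which of the six pairs of the marks
`o, a₁, a₂, b` are connected in `G′ = G − a₃`. Connection is an equivalence relation, so the
pattern is TRANSITIVE on every triple (`Consistent`): `innerPat3_consistent`. Hence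
`P(Π = π) = 0` for every inconsistent `π` (`prob_innerPat3_eq_zero_of_not_consistent`), and the
consistent patterns are exactly the `Bell(4) = 15` set partitions of the four marks
(`card_consistent`, by `decide`) — the 15 atoms of the inner law `m` of the a₃-hub table.
-/

namespace Summit.Ventures.PercRepro2.Hub3

open Hub

/-- **Consistency** of a pattern on the six pairs `oa₁, oa₂, ob, a₁a₂, a₁b, a₂b` (indices
`0, 1, 2, 3, 4, 5`): transitivity on each of the four triples of marks. -/
def Consistent (π : Fin 6 → Bool) : Prop :=
  (π 0 = true → π 1 = true → π 3 = true) ∧ (π 0 = true → π 3 = true → π 1 = true) ∧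
  (π 1 = true → π 3 = true → π 0 = true) ∧
  (π 0 = true → π 2 = true → π 4 = true) ∧ (π 0 = true → π 4 = true → π 2 = true) ∧
  (π 2 = true → π 4 = true → π 0 = true) ∧
  (π 1 = true → π 2 = true → π 5 = true) ∧ (π 1 = true → π 5 = true → π 2 = true) ∧
  (π 2 = true → π 5 = true → π 1 = true) ∧
  (π 3 = true → π 4 = true → π 5 = true) ∧ (π 3 = true → π 5 = true → π 4 = true) ∧
  (π 4 = true → π 5 = true → π 3 = true)

/-- Consistency is decidable. -/
instance : DecidablePred Consistent := fun π => by unfold Consistent; infer_instance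

/-- **Exactly 15 consistent patterns** — the set partitions of four marks. -/
theorem card_consistent : (Finset.univ.filter Consistent : Finset (Fin 6 → Bool)).card = 15 := by
  decide

variable {V : Type*} {E : Type*} {ends : E → Sym2 V} {μ : Mark → V}

/-- A connection recorded in the inner pattern. -/
lemma conn_of_innerPat3 {ω : Config E} {i : Fin 6} (h : innerPat3 ends μ ω i = true) :
    Conn ends (innerConfig3 ends μ ω) (μ (ipair3 i).1) (μ (ipair3 i).2) := by
  classical
  unfold innerPat3 at h
  exact of_decide_eq_true h

/-- A connection is recorded in the inner pattern. -/
lemma innerPat3_of_conn {ω : Config E} {i : Fin 6}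
    (h : Conn ends (innerConfig3 ends μ ω) (μ (ipair3 i).1) (μ (ipair3 i).2)) :
    innerPat3 ends μ ω i = true := by
  classical
  unfold innerPat3
  exact decide_eq_true h

/-- **The inner pattern is consistent** (connection is transitive and symmetric). -/
theorem innerPat3_consistent (ω : Config E) : Consistent (innerPat3 ends μ ω) := by
  have c := @conn_of_innerPat3 V E ends μ ω
  have r := @innerPat3_of_conn V E ends μ ω
  simp only [ipair3] at c r
  refine ⟨?_, ?_, ?_, ?_, ?_, ?_, ?_, ?_, ?_, ?_, ?_, ?_⟩ <;> intro h1 h2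
  -- triple o, a₁, a₂ (pairs 0 = oa₁, 1 = oa₂, 3 = a₁a₂)
  · exact r (i := 3) (conn_trans (conn_symm (c (i := 0) h1)) (c (i := 1) h2))
  · exact r (i := 1) (conn_trans (c (i := 0) h1) (c (i := 3) h2))
  · exact r (i := 0) (conn_trans (c (i := 1) h1) (conn_symm (c (i := 3) h2)))
  -- triple o, a₁, b (pairs 0 = oa₁, 2 = ob, 4 = a₁b)
  · exact r (i := 4) (conn_trans (conn_symm (c (i := 0) h1)) (c (i := 2) h2))
  · exact r (i := 2) (conn_trans (c (i := 0) h1) (c (i := 4) h2))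
  · exact r (i := 0) (conn_trans (c (i := 2) h1) (conn_symm (c (i := 4) h2)))
  -- triple o, a₂, b (pairs 1 = oa₂, 2 = ob, 5 = a₂b)
  · exact r (i := 5) (conn_trans (conn_symm (c (i := 1) h1)) (c (i := 2) h2))
  · exact r (i := 2) (conn_trans (c (i := 1) h1) (c (i := 5) h2))
  · exact r (i := 1) (conn_trans (c (i := 2) h1) (conn_symm (c (i := 5) h2)))
  -- triple a₁, a₂, b (pairs 3 = a₁a₂, 4 = a₁b, 5 = a₂b)
  · exact r (i := 5) (conn_trans (conn_symm (c (i := 3) h1)) (c (i := 4) h2))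
  · exact r (i := 4) (conn_trans (c (i := 3) h1) (c (i := 5) h2))
  · exact r (i := 3) (conn_trans (c (i := 4) h1) (conn_symm (c (i := 5) h2)))

variable [Fintype E] [DecidableEq E] {R : Type*} [CommRing R]

/-- **Inconsistent patterns carry no mass**: `P(Π = π) = 0` unless `π` is consistent. -/
theorem prob_innerPat3_eq_zero_of_not_consistent (p : E → R) {π : Fin 6 → Bool}
    (hπ : ¬ Consistent π) : prob p {ω | innerPat3 ends μ ω = π} = 0 := by
  have : {ω : Config E | innerPat3 ends μ ω = π} = ∅ := by
    ext ω
    simp only [Set.mem_setOf_eq, Set.mem_empty_iff_false, iff_false]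
    intro h
    exact hπ (h ▸ innerPat3_consistent ω)
  rw [this, prob_empty]

end Summit.Ventures.PercRepro2.Hub3
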